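import Summits.QuantumAdvantage.QuantumAdvantage.Theorems.CubicForrelationNearExactIsExactTwelveTypeO960At2932
import Summits.QuantumAdvantage.QuantumAdvantage.Theorems.CubicForrelationNearExactIsExactTwelveBase960CharSums

/-!
# Crux `CubicForrelation.NearExactIsExact` (stmt-QuantumAdvantage-14043) — n = 12, type O with base set `960` AT `Φ = 29/32`: a level-`≥ 6`
  PARTNER is impossible — hence NO type-O side with base `960` at `Φ ≥ 29/32` at all

Certificate seat `b2b-cforr-cert` (gen 22).  HONEST FRAMING: a kernel-checked lemma (standard axioms, no `decide`) about cubic Boolean pairs on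
12 bits — the last sub-case of the base-`960` configuration of the boundary rung `29/32` (HOME/b2b-cforr-cert-g22/PLAN-N12-928-EQ.md); with
`to22_typeO_E960_typeO_partner_false` / `to22_typeO_E960_levelFive_partner_false` (…TwelveTypeO960At2932) the base `960` is DEAD at `Φ ≥ 29/32`
(`to22_typeO_E960_ge2932_false`).  NO new value of `θ₁₂` by itself.  NOT summit progress.

`to22_typeO_E960_levelSix_partner_false`: cubic `f, g`, `W_g = 16u` (some `u` odd) with `#E = 960`, `W_f = 64w_f`, `Φ(f,g) ≥ 29/32` is
impossible.  Proof: by `to22_typeO_E960_ge2932_dichotomy` the wild function has `v̂ = 8k`, `k ∈ {0, ±4}`, `K = {k ≠ 0}` of size `128`; by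
`to22_char_sum_E960_structure` the character sums of `E` are `64m` with `m` odd exactly on a 9-dimensional subspace `M`; the partner identity
gives `w_f(y) = (−1)^g − 16s_b[y = c₁] + s_b m(c₁⊕y) − k(y)/4`, so the EVEN set `Z_f` of `w_f` is `M' Δ K`, `M' = c₁ ⊕ M`, of size
`640 − 2·#(M' ∩ K) ≤ 640`.  Level-6 theory of `f`: `w_f` is not odd everywhere (`f` would be bent: `tw_bent_end`), the parity of `w_f` is cubic,
so `#Z_f ≥ 512` and `#Z_f < 768 ⇒ #Z_f = 512` (`sw_cubic_second_weight`), `Z_f` a 9-flat (`mw_flat_of_minweight`); hence `#(M' ∩ K) = 64` and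
`Z_f ∩ M' = M' ∖ K` has `448` points.  But `Z_f ∩ M'` is a translate of the subspace `V₀ ∩ M`, whose size divides `4096`
(`card_mul_card_perp`) — and `448 ∤ 4096`.

References: Kasami–Tokura (1970); MacWilliams–Sloane (1977) Ch. 13–15; O'Donnell (2014) §3.3.  Axioms: the standard three.
-/

set_option linter.dupNamespace false -- D-0017: single-problem summit ⇒ `QuantumAdvantage.QuantumAdvantage` by design

noncomputable section

namespace Summit.QuantumAdvantage.QuantumAdvantage.Theorems.CubicForrelation.NearExactIsExact

open Finset
open Literature.Computability.QuantumComplexity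
open Literature.Computability.QuantumComplexity.BuzetChailloux (bxor zeroVec bxor_bxor_cancel_left bxor_zeroVec zeroVec_bxor bxor_comm
  bxor_self twist_zeroVec_right twist_bxor_right)
open Literature.Computability.QuantumComplexity.DerivativeWalsh (W card_mul_card_perp)
open Summit.QuantumAdvantage.QuantumAdvantage.Theorems.NearExactIsExact.Negative (TypeOTwelve.typeO_of_exists_odd)

/-- **No type-O(base `960`) × level-`≥ 6` pair at `Φ ≥ 29/32`** (12 bits).  See the module docstring.  Finite-slice statement, NOT summit
progress. [this work] -/
theorem to22_typeO_E960_levelSix_partner_false (f g : (Fin (6 + 6) → Bool) → Bool) (hf : IsDegLeFun 3 f) (hg : IsDegLeFun 3 g)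
    (u : (Fin (6 + 6) → Bool) → ℤ) (hu : ∀ x, W (fun y => signOf (g y)) x = (2 : ℝ) ^ 4 * (u x : ℝ))
    (hodd : ∃ x, Odd (u x)) (hE : #(univ.filter fun x : Fin (6 + 6) → Bool => (Odd (u x / 2) ↔ Odd (u x / 2 / 2))) = 960)
    (wf : (Fin (6 + 6) → Bool) → ℤ) (hwf : ∀ y, W (fun x => signOf (f x)) y = (2 : ℝ) ^ 6 * (wf y : ℝ))
    (hΦ : (29 / 32 : ℝ) ≤ forrelation f g) : False := by
  classical
  have hΦ' : forrelation g f = forrelation f g := by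
    rw [Summit.QuantumAdvantage.QuantumAdvantage.Theorems.SignedCubicForrelationNotPrBPP.Negative.HalfQuad.forrelation_comm]
  obtain ⟨hΦeq, uf, huf, -, -, v, hv, -, k, hk8, -, hkval, hcard⟩ := to22_typeO_E960_ge2932_dichotomy f g hf hg u hu hodd hE hΦ
  -- `u_f = 4 w_f`
  have huw : ∀ y, uf y = 4 * wf y := by
    intro y
    have h := (huf y).symm.trans (hwf y)
    have h' : ((uf y : ℤ) : ℝ) = ((4 * wf y : ℤ) : ℝ) := by
      push_cast
      have h2 : (2 : ℝ) ^ 4 ≠ 0 := by norm_num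
      have : (2 : ℝ) ^ 4 * (uf y : ℝ) = (2 : ℝ) ^ 4 * (4 * (wf y : ℝ)) := by rw [h]; ring
      exact mul_left_cancel₀ h2 this
    exact_mod_cast h'
  -- the affine digit and the base set as a cubic support
  have hall : ∀ x, Odd (u x) := TypeOTwelve.typeO_of_exists_odd g u hg hu hodd
  have hu' : ∀ x, W (fun y => signOf (g y)) x = (2 : ℝ) ^ (2 * 2) * (u x : ℝ) := fun x => (hu x).trans (by norm_num)
  have hd1 : IsDegLeFun 1 (fun x => decide (Odd (u x / 2))) := z2_digitOne 2 g u hg hu' hall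
  have hd2 : IsDegLeFun 3 (fun x => decide (Odd (u x / 2 / 2))) := z2_digitTwo 2 g u hg hu' hall
  obtain ⟨c₁, b₁, hcb⟩ := stub_affineForm (6 + 6) _ hd1
  set E := univ.filter (fun x : Fin (6 + 6) → Bool => (Odd (u x / 2) ↔ Odd (u x / 2 / 2))) with hEdef
  have hdegE : IsDegLeFun (2 + 1) (fun x => (decide (Odd (u x / 2)) ^^ decide (Odd (u x / 2 / 2))) ^^ true) :=
    tb_isDegLeFun_xor_const (bb_isDegLeFun_bxor (hd1.mono (by norm_num)) hd2) true
  have hsetE : (univ.filter fun x : Fin (6 + 6) → Bool =>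
      ((decide (Odd (u x / 2)) ^^ decide (Odd (u x / 2 / 2))) ^^ true) = true) = E := by
    rw [hEdef]
    apply filter_congr
    intro x _
    by_cases h1 : Odd (u x / 2) <;> by_cases h2 : Odd (u x / 2 / 2) <;> simp [h1, h2]
  -- the character sums of `E`: `Ê = 64 m`, `m` odd exactly on a 9-dimensional subspace `M`
  obtain ⟨mf, M, hEm, hM0, hMadd, hMcard, hMpar⟩ := to22_char_sum_E960_structure _ hdegE (by rw [hsetE]; exact hE)
  rw [hsetE] at hEm
  -- the partner identity: `4 w_f = 4(−1)^g − 64 s_b [y = c₁] + 4 s_b m(c₁ ⊕ y) − k`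
  have hsb : ((sZ b₁ : ℤ) : ℝ) = signOf b₁ := tp_sZ_cast _
  have hkm : ∀ y, k y = 4 * sZ (g y) - 64 * sZ b₁ * (if bxor c₁ y = (fun _ => false) then 1 else 0) +
      4 * sZ b₁ * mf (bxor c₁ y) - 4 * wf y := by
    intro y
    have h := to18_typeO_partner_identity f g u hu v hv c₁ b₁ hcb uf huf y
    rw [← hEdef, hEm, hk8, huw] at h
    have h' : ((k y : ℤ) : ℝ) = ((4 * sZ (g y) - 64 * sZ b₁ * (if bxor c₁ y = (fun _ => false) then 1 else 0) +
        4 * sZ b₁ * mf (bxor c₁ y) - 4 * wf y : ℤ) : ℝ) := by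
      have hsg := tp_sZ_cast (g y)
      rcases tp_sZ_cases b₁ with hs | hs
      all_goals
        rw [hs] at hsb ⊢
        push_cast at hsb h ⊢
        rw [← hsb, ← hsg] at h
        split_ifs with hz
        · rw [if_pos hz] at h
          have e4096 : (2 : ℝ) ^ (6 + 6) = 4096 := by norm_num
          rw [e4096] at h
          linarith
        · rw [if_neg hz] at h
          linarith
    exact_mod_cast h'
  -- the even set `Z_f` of `w_f` is `M' Δ K`
  set Zf := univ.filter (fun y : Fin (6 + 6) → Bool => ¬ Odd (wf y)) with hZfdef
  set M' := M.image (bxor c₁) with hM'def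
  set K := univ.filter (fun y : Fin (6 + 6) → Bool => k y ≠ 0) with hKdef
  have hmemM' : ∀ y, y ∈ M' ↔ bxor c₁ y ∈ M := by
    intro y
    rw [hM'def, mem_image]
    constructor
    · rintro ⟨a, ha, rfl⟩; rw [bxor_bxor_cancel_left]; exact ha
    · intro hy; exact ⟨bxor c₁ y, hy, bxor_bxor_cancel_left c₁ y⟩
  have hM'card : #M' = 512 := by
    rw [hM'def, card_image_of_injective _ (fun x y h => by
      have := congrArg (bxor c₁) h; rwa [bxor_bxor_cancel_left, bxor_bxor_cancel_left] at this), hMcard]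
  have hKcard : #K = 128 := hcard
  have hmemZ : ∀ y, y ∈ Zf ↔ (y ∈ M' ↔ y ∉ K) := by
    intro y
    rw [hZfdef, mem_filter, hmemM', ← hMpar, hKdef, mem_filter, Int.odd_iff, Int.odd_iff]
    have h := hkm y
    have hsg := tp_sZ_cases (g y)
    simp only [mem_univ, true_and, not_not]
    rcases tp_sZ_cases b₁ with hs | hs <;> rw [hs] at h <;> rcases hkval y with hk | hk | hk <;> rw [hk] at h ⊢ <;>
      split_ifs at h <;> omega
  -- counting: `#Z_f + 2·#(M' ∩ K) = 640`
  have hcount : (#Zf : ℤ) + 2 * #(M' ∩ K) = 640 := by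
    have hZ : (#Zf : ℤ) = ∑ y, (if (y ∈ M' ↔ y ∉ K) then 1 else 0 : ℤ) := by
      rw [sum_boole]
      have e : (univ.filter fun y => (y ∈ M' ↔ y ∉ K)) = Zf := by
        ext y; rw [mem_filter, hmemZ y]; simp only [mem_univ, true_and]
      rw [e]
    have hM'sum : (#M' : ℤ) = ∑ y, (if y ∈ M' then 1 else 0 : ℤ) := by
      rw [sum_boole]
      have e : (univ.filter fun y => y ∈ M') = M' := by ext y; rw [mem_filter]; simp only [mem_univ, true_and]
      rw [e]
    have hKsum : (#K : ℤ) = ∑ y, (if y ∈ K then 1 else 0 : ℤ) := by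
      rw [sum_boole]
      have e : (univ.filter fun y => y ∈ K) = K := by ext y; rw [mem_filter]; simp only [mem_univ, true_and]
      rw [e]
    have hIsum : (#(M' ∩ K) : ℤ) = ∑ y, (if (y ∈ M' ∧ y ∈ K) then 1 else 0 : ℤ) := by
      rw [sum_boole]
      have e : (univ.filter fun y => y ∈ M' ∧ y ∈ K) = M' ∩ K := by
        ext y; rw [mem_filter, mem_inter]; simp only [mem_univ, true_and]
      rw [e]
    have hpt : ∀ y, (if (y ∈ M' ↔ y ∉ K) then 1 else 0 : ℤ) + 2 * (if (y ∈ M' ∧ y ∈ K) then 1 else 0 : ℤ) =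
        (if y ∈ M' then 1 else 0 : ℤ) + (if y ∈ K then 1 else 0 : ℤ) := by
      intro y
      by_cases h1 : y ∈ M' <;> by_cases h2 : y ∈ K <;> simp [h1, h2]
    have h := sum_congr rfl fun y (_ : y ∈ (univ : Finset (Fin (6 + 6) → Bool))) => hpt y
    rw [sum_add_distrib, sum_add_distrib, ← mul_sum, ← hZ, ← hIsum, ← hM'sum, ← hKsum, hM'card, hKcard] at h
    push_cast at h
    linarith
  -- LEVEL-6 THEORY of `f`: Parseval, not bent, cubic parity, `#Z_f ∈ {512} ∪ [768, ∞)`, budget `#Z_f ≤ 768`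
  set u4 : (Fin (6 + 6) → Bool) → ℤ := fun y => 4 * wf y with hu4def
  have hu4 : ∀ y, W (fun x => signOf (f x)) y = (2 : ℝ) ^ 4 * (u4 y : ℝ) := by
    intro y; rw [hwf y]; simp only [u4]; push_cast; ring
  have hpar : ∑ y, wf y ^ 2 = 4096 := by
    have h := zms_sum_u_sq 2 f u4 (fun y => (hu4 y).trans (by norm_num))
    have e : ∑ y, ((u4 y : ℝ)) ^ 2 = 16 * ∑ y, ((wf y : ℝ)) ^ 2 := by
      rw [mul_sum]; exact sum_congr rfl fun y _ => by simp only [u4]; push_cast; ring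
    rw [e] at h
    norm_num at h
    have h' : ∑ y, ((wf y : ℝ)) ^ 2 = 4096 := by linarith
    exact_mod_cast h'
  have hnotbent : ∃ y, ¬ Odd (wf y) := by
    by_contra hall'
    push Not at hall'
    have hsq1' : ∀ y, wf y ^ 2 = 1 := by
      have hge : ∀ y, (1 : ℤ) ≤ wf y ^ 2 := fun y => by
        have h0 := Int.odd_iff.1 (hall' y)
        have : wf y ≤ -1 ∨ 1 ≤ wf y := by omega
        have := tp_sq_ge (k := 1) (by norm_num) this
        linarith
      have hsum0 : ∑ y, (wf y ^ 2 - 1 : ℤ) = 0 := by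
        rw [sum_sub_distrib, hpar, sum_const, card_univ, Fintype.card_fun, Fintype.card_bool, Fintype.card_fin]; norm_num
      intro y
      have := (sum_eq_zero_iff_of_nonneg fun z _ => by have := hge z; linarith).1 hsum0 y (mem_univ y)
      linarith
    have hbent : ∀ y, W (fun x => signOf (f x)) y ^ 2 = (2 : ℝ) ^ (6 + 6) := by
      intro y
      rw [hwf y, mul_pow]
      have : ((wf y : ℝ)) ^ 2 = 1 := by exact_mod_cast hsq1' y
      rw [this]; norm_num
    rcases tw_bent_end (by norm_num) g f hg hf hbent with h | h
    · rw [hΦ', hΦeq] at h; norm_num at h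
    · rw [hΦ', hΦeq] at h; norm_num at h
  obtain ⟨y₁, hy₁⟩ := hnotbent
  have hp : IsDegLeFun 3 (fun y => decide (Odd (wf y))) :=
    stub_walshTower stub_axParity (6 + 6) 6 3 f wf hf hwf (by intro k hk hkn; omega)
  have hp' : IsDegLeFun (2 + 1) (fun y => decide (Odd (wf y)) ^^ true) := tb_isDegLeFun_xor_const hp true
  have hfilt : (univ.filter fun y : Fin (6 + 6) → Bool => (decide (Odd (wf y)) ^^ true) = true) = Zf :=
    filter_congr fun y _ => by simp
  have hne : ∃ y, (decide (Odd (wf y)) ^^ true) = true := ⟨y₁, by simpa using hy₁⟩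
  have hRM := bb_rmWeight_holds (6 + 6) 3 (fun y => decide (Odd (wf y)) ^^ true) hp' hne
  rw [hfilt] at hRM
  have hZge : 512 ≤ #Zf := by norm_num at hRM; omega
  -- budget for `f`: `Σ (w_f − (−1)^g)² = 768`, each point of `Z_f` costs `≥ 1` (not needed beyond `#Z_f ≤ 640 < 768`)
  have hZcard : #Zf = 512 := by
    have hZle : #Zf ≤ 640 := by
      have : (#Zf : ℤ) ≤ 640 := by linarith [show (0 : ℤ) ≤ #(M' ∩ K) from by positivity]
      exact_mod_cast this
    have hsw := sw_cubic_second_weight (m := 6 + 6) _ hp' hne (by rw [hfilt]; norm_num; omega)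
    rw [hfilt] at hsw
    norm_num at hsw
    omega
  have hIcard : #(M' ∩ K) = 64 := by
    have : (#(M' ∩ K) : ℤ) = 64 := by rw [hZcard] at hcount; push_cast at hcount; linarith
    exact_mod_cast this
  -- `Z_f` is a 9-flat `xZ ⊕ V₀`
  have hmw := mw_flat_of_minweight 2 (fun y => decide (Odd (wf y)) ^^ true) hp' (by rw [hfilt, hZcard]; norm_num)
  rw [hfilt] at hmw
  obtain ⟨hV0, hVadd, hVcard, hVcoset⟩ := hmw
  set V₀ := univ.filter (fun a : Fin (6 + 6) → Bool => ∀ x,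
    (decide (Odd (wf (bxor x a))) ^^ true) = (decide (Odd (wf x)) ^^ true)) with hV₀
  obtain ⟨xZ, hxZ⟩ : Zf.Nonempty := card_pos.1 (by rw [hZcard]; norm_num)
  have hS : Zf = V₀.image (bxor xZ) := hVcoset xZ (by have h := (mem_filter.1 hxZ).2; simpa using h)
  -- `Z_f ∩ M'` has `448` points …
  have hZM : #(Zf ∩ M') = 448 := by
    have hsub : Zf ∩ M' = M'.filter (fun y => y ∉ K) := by
      ext y
      simp only [mem_inter, mem_filter]
      rw [hmemZ y]
      constructor
      · rintro ⟨h1, h2⟩; exact ⟨h2, h1.1 h2⟩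
      · rintro ⟨h1, h2⟩; exact ⟨⟨fun _ => h2, fun _ => h1⟩, h1⟩
    rw [hsub]
    have h := Finset.card_filter_add_card_filter_not (s := M') (fun y => y ∉ K)
    have e2 : M'.filter (fun y => ¬ y ∉ K) = M' ∩ K := by
      ext y; simp only [mem_filter, mem_inter, not_not]
    rw [e2, hIcard, hM'card] at h
    omega
  -- … but it is a translate of the subspace `V₀ ∩ M`, whose size divides `4096`
  obtain ⟨p, hp⟩ : (Zf ∩ M').Nonempty := card_pos.1 (by rw [hZM]; norm_num)
  have hpZ : p ∈ Zf := (mem_inter.1 hp).1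
  have hpM : p ∈ M' := (mem_inter.1 hp).2
  have hxor3 : ∀ a x y : Fin (6 + 6) → Bool, bxor (bxor a x) (bxor a y) = bxor x y := by
    intro a x y; funext i; simp only [bxor]; cases a i <;> cases x i <;> cases y i <;> rfl
  have hxor4 : ∀ a x y : Fin (6 + 6) → Bool, bxor a (bxor x y) = bxor (bxor a x) y := by
    intro a x y; funext i; simp only [bxor]; cases a i <;> cases x i <;> cases y i <;> rfl
  have himg : Zf ∩ M' = (V₀ ∩ M).image (bxor p) := by
    ext y
    simp only [mem_inter, Finset.mem_image]
    constructor
    · rintro ⟨hyZ, hyM⟩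
      refine ⟨bxor p y, ⟨?_, ?_⟩, bxor_bxor_cancel_left p y⟩
      · have h1 := fl1_coset_diff hS hpZ
        have h2 := fl1_coset_diff hS hyZ
        have := hVadd _ h1 _ h2
        rwa [hxor3] at this
      · have h1 := (hmemM' p).1 hpM
        have h2 := (hmemM' y).1 hyM
        have := hMadd _ h1 _ h2
        rwa [hxor3] at this
    · rintro ⟨a, ⟨haV, haM⟩, rfl⟩
      refine ⟨fl1_coset_vadd hVadd hS hpZ haV, ?_⟩
      rw [hmemM']
      have h1 := (hmemM' p).1 hpM
      have := hMadd _ h1 _ haM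
      rwa [← hxor4] at this
  have hVMcard : #(V₀ ∩ M) = 448 := by
    rw [← hZM, himg, card_image_of_injective _ (fun x y h => by
      have := congrArg (bxor p) h; rwa [bxor_bxor_cancel_left, bxor_bxor_cancel_left] at this)]
  have hVM0 : zeroVec ∈ V₀ ∩ M := mem_inter.2 ⟨hV0, hM0⟩
  have hVMadd : ∀ x ∈ V₀ ∩ M, ∀ y ∈ V₀ ∩ M, bxor x y ∈ V₀ ∩ M := fun x hx y hy =>
    mem_inter.2 ⟨hVadd _ (mem_inter.1 hx).1 _ (mem_inter.1 hy).1, hMadd _ (mem_inter.1 hx).2 _ (mem_inter.1 hy).2⟩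
  have hperp := card_mul_card_perp hVM0 hVMadd
  rw [hVMcard] at hperp
  have hnat : 448 * #(univ.filter fun y : Fin (6 + 6) → Bool => ∀ x ∈ V₀ ∩ M, twist x y = 1) = 4096 := by
    have h' : ((448 * #(univ.filter fun y : Fin (6 + 6) → Bool => ∀ x ∈ V₀ ∩ M, twist x y = 1) : ℕ) : ℝ) = ((4096 : ℕ) : ℝ) := by
      push_cast at hperp ⊢; rw [hperp]; norm_num
    exact_mod_cast h'
  omega

/-- **No type-O side with base set `960` at `Φ ≥ 29/32`** (12 bits): the partner would be type O, level 5 or level `≥ 6`, all three dead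
(`to22_typeO_E960_typeO_partner_false`, `to22_typeO_E960_levelFive_partner_false`, `to22_typeO_E960_levelSix_partner_false`).
Finite-slice statement, NOT summit progress. [this work] -/
theorem to22_typeO_E960_ge2932_false (f g : (Fin (6 + 6) → Bool) → Bool) (hf : IsDegLeFun 3 f) (hg : IsDegLeFun 3 g)
    (u : (Fin (6 + 6) → Bool) → ℤ) (hu : ∀ x, W (fun y => signOf (g y)) x = (2 : ℝ) ^ 4 * (u x : ℝ))
    (hodd : ∃ x, Odd (u x)) (hE : #(univ.filter fun x : Fin (6 + 6) → Bool => (Odd (u x / 2) ↔ Odd (u x / 2 / 2))) = 960)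
    (hΦ : (29 / 32 : ℝ) ≤ forrelation f g) : False := by
  obtain ⟨uf, huf⟩ := tw_base (n := 6 + 6) f hf 4 (by norm_num)
  by_cases hO : ∃ y, Odd (uf y)
  · exact to22_typeO_E960_typeO_partner_false f g hf hg u hu hodd hE uf huf hO hΦ
  push Not at hO
  have huf5 := tw_level_up (j := 4) f uf huf hO
  by_cases hO5 : ∃ y, Odd (uf y / 2)
  · exact to22_typeO_E960_levelFive_partner_false f g hf hg u hu hodd hE (fun y => uf y / 2) huf5 hO5 hΦ
  push Not at hO5
  have huf6 := tw_level_up (j := 5) f (fun y => uf y / 2) huf5 hO5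
  exact to22_typeO_E960_levelSix_partner_false f g hf hg u hu hodd hE (fun y => uf y / 2 / 2) huf6 hΦ

end Summit.QuantumAdvantage.QuantumAdvantage.Theorems.CubicForrelation.NearExactIsExact

end
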